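import Summits.QuantumFields.YangMills.Theorems.AllWindowsColdBoxBulkMidFluxExtensionComb

/-!
# LINE-18 (crux `AllWindowsColdBox.BulkMidWindowSU2`, ⟨stmt-QuantumFields-24006⟩), toward the gauge-invariant flux maximum
# principle K3″: a GAUGE on the boundary 3-sphere of the enlarged box with LINEAR loss

For an edge function `ϑ` whose circulations over the SHELL plaquettes of the enlarged box `Λ⁺ = {−1,…,2H+1}⁴` (plaquettes of
`Λ⁺` with a coordinate extremal at all four vertices) are `≤ ε` in absolute value, the explicit vertex potential `gaugePot`
satisfies `|ϑ(e) − (Φ(e⁺) − Φ(e⁻))| ≤ 15(2H+2)·ε` on EVERY tangential shell edge `e` of `Λ⁺` (`abs_sub_gaugePot_le`, sibling file `…BulkMidFluxExtensionGauge`; here: the potential, the cap comb defect with fluxes of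
plaquettes OF the enlarged box only, and the mismatch bounds `abs_mis_step_le` / `abs_mis_le`).
Construction (coordinate `0` = "vertical"; `Y`-coordinates `1,2,3`): comb potential on the bottom cap `{y₀ = −1}`, comb
potential on the top cap `{y₀ = 2H+1}`, and on the side `{some y_k extremal, k ≠ 0}` the vertical line integral from the
bottom cap minus the fraction `(y₀+1)/(2H+2)` of the top-rim mismatch `h` — so that only `h/(2H+2)` (`|h| ≤ 15(2H+2)²ε` by a
three-segment rim path from the corner column) enters the vertical edges.  This evades the obstruction that no path-integration
gauge on a cubical 2- or 3-sphere has linear loss.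

Finite sums only.  HONEST LABEL: helper toward an UNREGISTERED internal obligation (K3″) of a critic-passed DRAFT line on the
R2ξ″ RECORD-rung crux 24006; no stub, crux, rung or summit is proved here; the Yang–Mills mass gap is NOT proved by this file.
-/

set_option autoImplicit false

noncomputable section

open Classical Finset Function
open Literature.Probability.LatticeModels (Site)
open Literature.MathematicalPhysics.QuantumFieldTheory
open Literature.MathematicalPhysics.QuantumFieldTheory.LatticeMaxwell

namespace Summit.QuantumFields.YangMills.Theorems.AllWindowsColdBoxBulkMidLine.FluxExt

variable (H : ℕ) (ϑ : Literature.MathematicalPhysics.QuantumLattice.ZdEdge 4 → ℝ)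

/-! ## The potential -/

/-- The side predicate: some `Y`-coordinate (`k ≠ 0`) is extremal. -/
def bdY (y : Site 4) : Prop := ∃ k : Fin 4, k ≠ 0 ∧ (y k = -1 ∨ y k = 2 * (H : ℤ) + 1)

/-- Bottom-cap comb potential, read at the floor point `y|_{y₀ = −1}`. -/
def potB (y : Site 4) : ℝ := comb ϑ (update y 0 (-1))

/-- The corner column's top point `(2H+1, −1, −1, −1)`. -/
def cornerTop : Site 4 := fun k => if k = 0 then 2 * (H : ℤ) + 1 else -1

/-- Top-cap comb potential (read at `y|_{y₀ = 2H+1}`), normalised by the vertical line integral up the corner column. -/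
def potT (y : Site 4) : ℝ := comb ϑ (update y 0 (2 * (H : ℤ) + 1)) + lineInt ϑ 0 (cornerTop H)

/-- The top-rim mismatch `h = potB + (vertical line integral to the top) − potT` (a function of the `Y`-coordinates). -/
def mis (y : Site 4) : ℝ := potB ϑ y + lineInt ϑ 0 (update y 0 (2 * (H : ℤ) + 1)) - potT H ϑ y

/-- **The gauge potential** `Φ`: cap combs on the caps; on the side, bottom comb + vertical line integral − `(y₀+1)/(2H+2)·h`. -/
def gaugePot (y : Site 4) : ℝ :=
  (if y 0 = 2 * (H : ℤ) + 1 ∧ ¬ bdY H y then potT H ϑ y else potB ϑ y) +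
    (if bdY H y then lineInt ϑ 0 y - (((y 0 : ℤ) : ℝ) + 1) / (2 * H + 2) * mis H ϑ y else 0)

variable {H ϑ} {ε : ℝ} (hε : 0 ≤ ε)
  (hflux : ∀ (z : Site 4) (a b c : Fin 4), a ≠ b → c ≠ a → c ≠ b → (∀ m, -1 ≤ z m ∧ z m ≤ 2 * (H : ℤ) + 1) →
    z a ≤ 2 * (H : ℤ) → z b ≤ 2 * (H : ℤ) → (z c = -1 ∨ z c = 2 * (H : ℤ) + 1) → |sCirc ϑ (z, a, b)| ≤ ε)

/-! ## Comb defect on a cap (fluxes of plaquettes OF the enlarged box only) -/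

include hε hflux in
/-- Comb defect bound on a cap edge `(y, i)` (`y₀` extremal, `i ≠ 0`, `y_i ≤ 2H`): `|ϑ(y,i) − dcomb| ≤ (4H+4)ε`, using only the
circulations of cap plaquettes that are plaquettes of the enlarged box. -/
theorem abs_comb_defect_le' {y : Site 4} (hy : ∀ m, -1 ≤ y m ∧ y m ≤ 2 * (H : ℤ) + 1)
    (hy0 : y 0 = -1 ∨ y 0 = 2 * (H : ℤ) + 1) {i : Fin 4} (hi : i ≠ 0) (hyi : y i ≤ 2 * (H : ℤ)) :
    |ϑ (y, i) - (comb ϑ (y + Pi.single i 1) - comb ϑ y)| ≤ (4 * H + 4) * ε := by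
  have hy2 := hy 2; have hy3 := hy 3
  have hn2 : ((y 2 + 1).toNat : ℝ) ≤ 2 * H + 2 := by
    have : (y 2 + 1).toNat ≤ 2 * H + 2 := by omega
    exact_mod_cast this
  have hn3 : ((y 3 + 1).toNat : ℝ) ≤ 2 * H + 2 := by
    have : (y 3 + 1).toNat ≤ 2 * H + 2 := by omega
    exact_mod_cast this
  have hS3 : ∀ a : Fin 4, a ≠ 0 → a ≠ 3 → y a ≤ 2 * (H : ℤ) →
      |∑ m ∈ range (y 3 + 1).toNat, sCirc ϑ (update y 3 (-1 + (m : ℤ)), a, 3)| ≤ (2 * H + 2) * ε := by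
    intro a ha0 ha3 hya
    refine (abs_sum_range_le fun m hm => ?_).trans (mul_le_mul_of_nonneg_right hn3 hε)
    refine hflux _ a 3 0 ha3 ha0.symm (by decide) ?_ ?_ ?_ ?_
    · intro k; by_cases hk : k = 3
      · subst hk; simp; omega
      · simp [hk]; exact hy k
    · simp [update_of_ne ha3, hya]
    · simp; omega
    · simpa using hy0
  have hS2 : y 1 ≤ 2 * (H : ℤ) →
      |∑ m ∈ range (y 2 + 1).toNat, sCirc ϑ (update (update y 3 (-1)) 2 (-1 + (m : ℤ)), 1, 2)| ≤ (2 * H + 2) * ε := by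
    intro hy1
    refine (abs_sum_range_le fun m hm => ?_).trans (mul_le_mul_of_nonneg_right hn2 hε)
    refine hflux _ 1 2 0 (by decide) (by decide) (by decide) ?_ ?_ ?_ ?_
    · intro k; by_cases hk2 : k = 2
      · subst hk2; simp; omega
      · by_cases hk3 : k = 3
        · subst hk3; simp; omega
        · simp [hk2, hk3]; exact hy k
    · simpa using hy1
    · simp; omega
    · simpa using hy0
  have hH : (0 : ℝ) ≤ (2 * H + 2) * ε := by positivity
  fin_cases i
  · exact absurd rfl hi
  · rw [show ((⟨1, by norm_num⟩ : Fin 4)) = 1 from rfl] at hyi ⊢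
    rw [comb_defect_one ϑ (hy 1).1 (hy 2).1 (hy 3).1]
    calc _ ≤ |-(∑ m ∈ range (y 2 + 1).toNat, sCirc ϑ (update (update y 3 (-1)) 2 (-1 + (m : ℤ)), 1, 2))| +
          |∑ m ∈ range (y 3 + 1).toNat, sCirc ϑ (update y 3 (-1 + (m : ℤ)), 1, 3)| := abs_sub _ _
      _ ≤ (2 * H + 2) * ε + (2 * H + 2) * ε := by
          rw [abs_neg]; exact add_le_add (hS2 hyi) (hS3 1 (by decide) (by decide) hyi)
      _ = (4 * H + 4) * ε := by ring
  · rw [show ((⟨2, by norm_num⟩ : Fin 4)) = 2 from rfl] at hyi ⊢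
    rw [comb_defect_two ϑ (hy 2).1 (hy 3).1, abs_neg]
    exact (hS3 2 (by decide) (by decide) hyi).trans (by nlinarith)
  · rw [show ((⟨3, by norm_num⟩ : Fin 4)) = 3 from rfl, comb_defect_three ϑ (hy 3).1, abs_zero]
    positivity

/-! ## The top-rim mismatch -/

/-- Auxiliary coordinate facts for floor/ceiling points. -/
theorem range_update_zero {y : Site 4} (hy : ∀ m, -1 ≤ y m ∧ y m ≤ 2 * (H : ℤ) + 1) {s : ℤ}
    (hs : s = -1 ∨ s = 2 * (H : ℤ) + 1) : ∀ m, -1 ≤ update y 0 s m ∧ update y 0 s m ≤ 2 * (H : ℤ) + 1 := by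
  intro m
  by_cases hm : m = 0
  · subst hm; simp; rcases hs with rfl | rfl <;> constructor <;> omega
  · simp [hm]; exact hy m

include hε hflux in
/-- **The mismatch varies slowly along rim edges**: for `i ≠ 0`, an extremal `Y`-coordinate `k ∉ {0, i}` and `y_i ≤ 2H`,
`|h(y + e_i) − h(y)| ≤ 5(2H+2)ε`. -/
theorem abs_mis_step_le {y : Site 4} (hy : ∀ m, -1 ≤ y m ∧ y m ≤ 2 * (H : ℤ) + 1) {i k : Fin 4} (hi : i ≠ 0)
    (hk0 : k ≠ 0) (hki : k ≠ i) (hyk : y k = -1 ∨ y k = 2 * (H : ℤ) + 1) (hyi : y i ≤ 2 * (H : ℤ)) :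
    |mis H ϑ (y + Pi.single i 1) - mis H ϑ y| ≤ 5 * (2 * H + 2) * ε := by
  have hfl : update (y + Pi.single i (1 : ℤ)) 0 (-1 : ℤ) = update y 0 (-1) + Pi.single i 1 :=
    update_add_single_of_ne hi y _
  have hcl : update (y + Pi.single i (1 : ℤ)) 0 (2 * (H : ℤ) + 1) = update y 0 (2 * (H : ℤ) + 1) + Pi.single i 1 :=
    update_add_single_of_ne hi y _
  have hc0 : (-1 : ℤ) ≤ (update y 0 (2 * (H : ℤ) + 1) : Site 4) 0 := by simp; omega
  have hli := lineInt_add_single_of_ne ϑ hi hc0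
  have hM : (((update y 0 (2 * (H : ℤ) + 1) : Site 4) 0 + 1).toNat) = 2 * H + 2 := by simp; omega
  rw [hM] at hli
  simp only [update_idem] at hli
  -- the two cap defects
  have dB := abs_comb_defect_le' hε hflux (range_update_zero hy (Or.inl rfl)) (Or.inl (by simp)) hi
    (by simpa [update_of_ne hi] using hyi)
  have dT := abs_comb_defect_le' hε hflux (range_update_zero hy (Or.inr rfl)) (Or.inr (by simp)) hi
    (by simpa [update_of_ne hi] using hyi)
  -- the side strip
  have hS : |∑ m ∈ range (2 * H + 2), sCirc ϑ (update y 0 (-1 + (m : ℤ)), i, 0)| ≤ (2 * H + 2) * ε := by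
    refine (abs_sum_range_le fun m hm => ?_).trans (by push_cast; rfl)
    refine hflux _ i 0 k hi hki hk0 ?_ ?_ ?_ ?_
    · intro m'; by_cases hm' : m' = 0
      · subst hm'; simp; omega
      · simp [hm']; exact hy m'
    · simpa [update_of_ne hi] using hyi
    · simp; omega
    · simpa [update_of_ne hk0] using hyk
  have key : mis H ϑ (y + Pi.single i 1) - mis H ϑ y =
      -(ϑ (update y 0 (-1), i) - (comb ϑ (update y 0 (-1) + Pi.single i 1) - comb ϑ (update y 0 (-1)))) +
      (ϑ (update y 0 (2 * (H : ℤ) + 1), i) -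
        (comb ϑ (update y 0 (2 * (H : ℤ) + 1) + Pi.single i 1) - comb ϑ (update y 0 (2 * (H : ℤ) + 1)))) +
      ∑ m ∈ range (2 * H + 2), sCirc ϑ (update y 0 (-1 + (m : ℤ)), i, 0) := by
    simp only [mis, potB, potT, hfl, hcl]
    linarith
  rw [key]
  calc _ ≤ |-(ϑ (update y 0 (-1), i) - (comb ϑ (update y 0 (-1) + Pi.single i 1) - comb ϑ (update y 0 (-1))))| +
        |ϑ (update y 0 (2 * (H : ℤ) + 1), i) -
          (comb ϑ (update y 0 (2 * (H : ℤ) + 1) + Pi.single i 1) - comb ϑ (update y 0 (2 * (H : ℤ) + 1)))| +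
        |∑ m ∈ range (2 * H + 2), sCirc ϑ (update y 0 (-1 + (m : ℤ)), i, 0)| :=
        (abs_add_le _ _).trans (add_le_add (abs_add_le _ _) le_rfl)
    _ ≤ (4 * H + 4) * ε + (4 * H + 4) * ε + (2 * H + 2) * ε := by rw [abs_neg]; gcongr
    _ = 5 * (2 * H + 2) * ε := by ring

/-- `h` vanishes on the corner column (all `Y`-coordinates `−1`). -/
theorem mis_eq_zero_of_corner {y : Site 4} (hy : ∀ k : Fin 4, k ≠ 0 → y k = -1) : mis H ϑ y = 0 := by
  have hc : update y 0 (2 * (H : ℤ) + 1) = cornerTop H := by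
    ext k; by_cases hk : k = 0
    · subst hk; simp [cornerTop]
    · simp [hk, cornerTop, hy k hk]
  have hcomb : ∀ s : ℤ, comb ϑ (update y 0 s) = 0 := by
    intro s
    simp [comb, lineInt, hy 1 (by decide), hy 2 (by decide), hy 3 (by decide)]
  have hcT : comb ϑ (cornerTop H) = 0 := by simp [comb, lineInt, cornerTop]
  have h1 := hcomb (-1)
  simp only [mis, potB, potT, h1, hc, hcT, zero_add, sub_self]

include hε hflux in
/-- A rim segment: moving coordinate `j ∉ {0,k}` by `n` steps from the floor value `−1`, with `k ≠ 0` extremal throughout, changes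
`h` by at most `n · 5(2H+2)ε`. -/
theorem abs_mis_segment_le {w : Site 4} (hw : ∀ m, -1 ≤ w m ∧ w m ≤ 2 * (H : ℤ) + 1) {j k : Fin 4} (hj : j ≠ 0)
    (hk0 : k ≠ 0) (hkj : k ≠ j) (hwk : w k = -1 ∨ w k = 2 * (H : ℤ) + 1) :
    ∀ n : ℕ, (n : ℤ) ≤ 2 * H + 2 →
      |mis H ϑ (update w j (-1 + (n : ℤ))) - mis H ϑ (update w j (-1))| ≤ n * (5 * (2 * H + 2) * ε) := by
  intro n
  induction n with
  | zero => intro _; simp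
  | succ n ih =>
    intro hn
    have hstep : update w j (-1 + ((n + 1 : ℕ) : ℤ)) = update w j (-1 + (n : ℤ)) + Pi.single j 1 := by
      rw [update_add_single_succ]
    have hr : ∀ m, -1 ≤ update w j (-1 + (n : ℤ)) m ∧ update w j (-1 + (n : ℤ)) m ≤ 2 * (H : ℤ) + 1 := by
      intro m; by_cases hm : m = j
      · subst hm; simp; omega
      · simp [hm]; exact hw m
    have h1 := abs_mis_step_le hε hflux hr hj hk0 hkj (by simpa [update_of_ne hkj] using hwk) (by simp; omega)
    have h2 := ih (by omega)
    rw [hstep]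
    calc _ ≤ |mis H ϑ (update w j (-1 + (n : ℤ)) + Pi.single j 1) - mis H ϑ (update w j (-1 + (n : ℤ)))| +
          |mis H ϑ (update w j (-1 + (n : ℤ))) - mis H ϑ (update w j (-1))| := abs_sub_le _ _ _
      _ ≤ 5 * (2 * H + 2) * ε + n * (5 * (2 * H + 2) * ε) := add_le_add h1 h2
      _ = ((n + 1 : ℕ) : ℝ) * (5 * (2 * H + 2) * ε) := by push_cast; ring

/-- Four pairwise distinct elements of `Fin 4` exhaust it. -/
theorem fin4_cover : ∀ a b c d m : Fin 4, a ≠ b → a ≠ c → a ≠ d → b ≠ c → b ≠ d → c ≠ d →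
    m = a ∨ m = b ∨ m = c ∨ m = d := by decide

include hε hflux in
/-- **The mismatch is at most quadratic**: `|h(y)| ≤ 15(2H+2)²ε` at every side point (three rim segments from the corner column). -/
theorem abs_mis_le {y : Site 4} (hy : ∀ m, -1 ≤ y m ∧ y m ≤ 2 * (H : ℤ) + 1) (hbd : bdY H y) :
    |mis H ϑ y| ≤ 15 * (2 * H + 2) ^ 2 * ε := by
  obtain ⟨k, hk0, hyk⟩ := hbd
  obtain ⟨j₁, j₂, h10, h1k, h20, h2k, h12⟩ := exists_other_two hk0.symm
  have hcov := fun m => fin4_cover 0 k j₁ j₂ m hk0.symm h10.symm h20.symm h1k.symm h2k.symm h12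
  set Q1 : Site 4 := update y j₂ (-1) with hQ1
  set Q0 : Site 4 := update Q1 j₁ (-1) with hQ0
  set b : Site 4 := update Q0 k (-1) with hb
  have hQ1r : ∀ m, -1 ≤ Q1 m ∧ Q1 m ≤ 2 * (H : ℤ) + 1 := by
    intro m; by_cases hm : m = j₂
    · subst hm; simp [hQ1]; omega
    · simp [hQ1, hm]; exact hy m
  have hQ0r : ∀ m, -1 ≤ Q0 m ∧ Q0 m ≤ 2 * (H : ℤ) + 1 := by
    intro m; by_cases hm : m = j₁
    · subst hm; simp [hQ0]; omega
    · simp [hQ0, hm]; exact hQ1r m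
  have hb0 : mis H ϑ b = 0 := by
    refine mis_eq_zero_of_corner fun m hm => ?_
    rcases hcov m with h | h | h | h
    · exact absurd h hm
    · subst h; simp [hb]
    · subst h; simp [hb, hQ0, update_of_ne h1k]
    · subst h; simp [hb, hQ0, hQ1, update_of_ne h2k, update_of_ne h12.symm]
  have hM : (0 : ℝ) ≤ 5 * (2 * H + 2) * ε := by positivity
  -- segment 0 : `b → Q0` along `k`
  have s0 : |mis H ϑ Q0 - mis H ϑ b| ≤ (2 * H + 2) * (5 * (2 * H + 2) * ε) := by
    rcases hyk with hyk | hyk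
    · have : b = Q0 := by
        rw [hb, ← hyk]
        have : Q0 k = y k := by simp [hQ0, hQ1, update_of_ne h1k.symm, update_of_ne h2k.symm]
        rw [← this, update_eq_self]
      rw [this, sub_self, abs_zero]; positivity
    · have hseg := abs_mis_segment_le hε hflux hQ0r hk0 h10 h1k (Or.inl (by simp [hQ0])) (2 * H + 2)
        (by push_cast; omega)
      have hend : update Q0 k (-1 + ((2 * H + 2 : ℕ) : ℤ)) = Q0 := by
        have : Q0 k = y k := by simp [hQ0, hQ1, update_of_ne h1k.symm, update_of_ne h2k.symm]
        rw [show (-1 : ℤ) + ((2 * H + 2 : ℕ) : ℤ) = Q0 k by rw [this, hyk]; push_cast; ring, update_eq_self]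
      rw [hend, ← hb] at hseg
      exact hseg.trans (by push_cast; rfl)
  -- segment 1 : `Q0 → Q1` along `j₁`
  have s1 : |mis H ϑ Q1 - mis H ϑ Q0| ≤ (2 * H + 2) * (5 * (2 * H + 2) * ε) := by
    have hn : ((y j₁ + 1).toNat : ℤ) ≤ 2 * H + 2 := by have := hy j₁; omega
    have hseg := abs_mis_segment_le hε hflux hQ1r h10 hk0 h1k.symm
      (by simpa [hQ1, update_of_ne h2k.symm] using hyk) (y j₁ + 1).toNat hn
    have hend : update Q1 j₁ (-1 + (((y j₁ + 1).toNat : ℕ) : ℤ)) = Q1 := by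
      have h1 : Q1 j₁ = y j₁ := by simp [hQ1, update_of_ne h12]
      rw [show (-1 : ℤ) + (((y j₁ + 1).toNat : ℕ) : ℤ) = Q1 j₁ by rw [h1]; have := hy j₁; omega, update_eq_self]
    rw [hend, ← hQ0] at hseg
    refine hseg.trans (mul_le_mul_of_nonneg_right ?_ hM)
    have := hy j₁
    have : ((y j₁ + 1).toNat : ℝ) ≤ 2 * H + 2 := by
      have : (y j₁ + 1).toNat ≤ 2 * H + 2 := by omega
      exact_mod_cast this
    exact this
  -- segment 2 : `Q1 → y` along `j₂`
  have s2 : |mis H ϑ y - mis H ϑ Q1| ≤ (2 * H + 2) * (5 * (2 * H + 2) * ε) := by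
    have hn : ((y j₂ + 1).toNat : ℤ) ≤ 2 * H + 2 := by have := hy j₂; omega
    have hseg := abs_mis_segment_le hε hflux hy h20 hk0 h2k.symm hyk (y j₂ + 1).toNat hn
    have hend : update y j₂ (-1 + (((y j₂ + 1).toNat : ℕ) : ℤ)) = y := by
      rw [show (-1 : ℤ) + (((y j₂ + 1).toNat : ℕ) : ℤ) = y j₂ by have := hy j₂; omega, update_eq_self]
    rw [hend, ← hQ1] at hseg
    refine hseg.trans (mul_le_mul_of_nonneg_right ?_ hM)
    have : ((y j₂ + 1).toNat : ℝ) ≤ 2 * H + 2 := by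
      have : (y j₂ + 1).toNat ≤ 2 * H + 2 := by have := hy j₂; omega
      exact_mod_cast this
    exact this
  have htri : |mis H ϑ y| ≤ |mis H ϑ y - mis H ϑ Q1| + |mis H ϑ Q1 - mis H ϑ Q0| + |mis H ϑ Q0 - mis H ϑ b| := by
    have e : mis H ϑ y = (mis H ϑ y - mis H ϑ Q1) + (mis H ϑ Q1 - mis H ϑ Q0) + (mis H ϑ Q0 - mis H ϑ b) := by
      rw [hb0]; ring
    calc |mis H ϑ y| = |(mis H ϑ y - mis H ϑ Q1) + (mis H ϑ Q1 - mis H ϑ Q0) + (mis H ϑ Q0 - mis H ϑ b)| := by rw [← e]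
      _ ≤ _ := (abs_add_le _ _).trans (add_le_add (abs_add_le _ _) le_rfl)
  calc |mis H ϑ y| ≤ (2 * H + 2) * (5 * (2 * H + 2) * ε) + (2 * H + 2) * (5 * (2 * H + 2) * ε) +
        (2 * H + 2) * (5 * (2 * H + 2) * ε) := htri.trans (add_le_add (add_le_add s2 s1) s0)
    _ = 15 * (2 * H + 2) ^ 2 * ε := by ring

end Summit.QuantumFields.YangMills.Theorems.AllWindowsColdBoxBulkMidLine.FluxExt

end
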